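import Summits.ABC.ABC.Theses.IneffectiveSubspace

/-!
# Sketch — crux `DeepRegimeABC` (stmt-ABC-15121), crux-ideate round 1, ideator 2

Card `omega-collapse`: the depth threshold of the crux is decorative.

* `ManyPrimesABC` := abc on an ε-dependent MANY-PRIMES tail
  (`∀ ε ∃ W ∃ C`, every abc triple with `ω(abc) ≥ W` has `c < C·rad^{1+ε}`).
* `deepRegime_of_manyPrimes`  : `ManyPrimesABC → DeepRegimeABC` (trivial, `ω₅ ≤ ω`).
* `manyPrimes_of_deepRegime`  : `DeepRegimeABC → ManyPrimesABC` (ONE quintic breeding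
  `(c⁵ − b⁵) + b⁵ = c⁵`: every prime of `bc` becomes 5-deep, the radical grows by at most the
  factor `Φ₅(c,b) ≤ 5c⁴`, and the exponent loss `1+η ↦ (1+η)/(1−4η)` is undone by choosing
  `η = ε/(5+4ε)`).
* `deepRegime_iff_manyPrimes`  : the crux is EQUIVALENT, as a bare statement, to abc off the
  bounded-ω (S-unit / Pillai) corner.
* `manyPrimesSubset_iff_abc`   : PADDING LEMMA — the unsaturated phrasing (support ⊆ S, |S| ≥ W, radical
  ↦ ∏_{p∈S} p) is already ABC; the crux's content is SATURATION.
* `abc_iff_boundedOmega_and_manyPrimes`, `abc_of_deepRegime_of_boundedOmega` (round 1's complement theorem,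
  now sorry-free), `closes_rebased`.
All theorems here are sorry-free; axioms propext / Classical.choice / Quot.sound (farm, 2026-08-16).

Everything is over existing declarations:
`Summit.ABC.ABC.Theses.IneffectiveSubspace.DeepRegimeABC` (the crux, by name),
`Literature.NumberTheory.DiophantineGeometry.{IsABCTriple, rad, rad_def}`, Mathlib.
-/

namespace Summit.ABC.ABC.Cruxes.DeepRegimeABC.OmegaCollapse

open Literature.NumberTheory.DiophantineGeometry
open Summit.ABC.ABC.Theses.IneffectiveSubspace

/-! ## Counters and the transfer target -/

/-- `ω(abc)`, the number of distinct primes of `abc`. -/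
def omega (a b c : ℕ) : ℕ := (a * b * c).primeFactors.card

/-- `ω₅(abc) = #{p : p⁵ ∣ abc}` — literally the cell expression of the crux `DeepRegimeABC`. -/
def depth5 (a b c : ℕ) : ℕ :=
  ((a * b * c).primeFactors.filter (fun p => 5 ≤ (a * b * c).factorization p)).card

/-- **ManyPrimesABC** (transfer target `C⁺` of card `omega-collapse`): abc on an ε-dependent
many-primes tail — for every `ε > 0` there are `W` and `C > 0` such that every abc triple with
`ω(abc) ≥ W` satisfies `c < C · rad(abc)^{1+ε}`.  Level-free, depth-free. -/
def ManyPrimesABC : Prop :=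
  ∀ ε : ℝ, 0 < ε → ∃ W : ℕ, ∃ C : ℝ, 0 < C ∧ ∀ a b c : ℕ, IsABCTriple a b c → W ≤ omega a b c →
    (c : ℝ) < C * ((rad a b c : ℕ) : ℝ) ^ (1 + ε)

/-- The crux, unfolded: it is literally the `depth5`-tail statement. -/
theorem deepRegimeABC_iff :
    DeepRegimeABC ↔ ∀ ε : ℝ, 0 < ε → ∃ K : ℕ, ∃ C : ℝ, 0 < C ∧ ∀ a b c : ℕ, IsABCTriple a b c →
      K ≤ depth5 a b c → (c : ℝ) < C * ((rad a b c : ℕ) : ℝ) ^ (1 + ε) :=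
  Iff.rfl

theorem depth5_le_omega (a b c : ℕ) : depth5 a b c ≤ omega a b c :=
  Finset.card_filter_le _ _

/-- Trivial direction: the many-primes tail contains the deep tail (`ω₅ ≤ ω`). -/
theorem deepRegime_of_manyPrimes (h : ManyPrimesABC) : DeepRegimeABC := by
  intro ε hε
  obtain ⟨W, C, hC, hW⟩ := h ε hε
  exact ⟨W, C, hC, fun a b c habc hK => hW a b c habc (hK.trans (depth5_le_omega a b c))⟩

/-! ## Quintic breeding -/

/-- `Φ₅(c,b) = (c⁵ − b⁵)/(c − b)`. -/
def Phi (b c : ℕ) : ℕ := c ^ 4 + c ^ 3 * b + c ^ 2 * b ^ 2 + c * b ^ 3 + b ^ 4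

theorem Phi_pos {b c : ℕ} (hc : 0 < c) : 0 < Phi b c := by
  unfold Phi
  have : 0 < c ^ 4 := pow_pos hc 4
  omega

theorem Phi_le {b c : ℕ} (hbc : b ≤ c) : Phi b c ≤ 5 * c ^ 4 := by
  unfold Phi
  have h1 : c ^ 3 * b ≤ c ^ 3 * c := Nat.mul_le_mul_left _ hbc
  have h2 : c ^ 2 * b ^ 2 ≤ c ^ 2 * c ^ 2 := Nat.mul_le_mul_left _ (Nat.pow_le_pow_left hbc 2)
  have h3 : c * b ^ 3 ≤ c * c ^ 3 := Nat.mul_le_mul_left _ (Nat.pow_le_pow_left hbc 3)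
  have h4 : b ^ 4 ≤ c ^ 4 := Nat.pow_le_pow_left hbc 4
  have e1 : c ^ 3 * c = c ^ 4 := by ring
  have e2 : c ^ 2 * c ^ 2 = c ^ 4 := by ring
  have e3 : c * c ^ 3 = c ^ 4 := by ring
  omega

/-- `c⁵ − b⁵ = a · Φ₅(c,b)` when `a + b = c`. -/
theorem pow_five_sub_eq {a b c : ℕ} (h : a + b = c) : c ^ 5 - b ^ 5 = a * Phi b c := by
  subst h
  apply Nat.sub_eq_of_eq_add
  unfold Phi
  ring

/-- Breeding preserves abc triples: `(c⁵ − b⁵) + b⁵ = c⁵`. (Same statement as r1-k1's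
`isABCTriple_breed`; reproved here to keep this file self-contained.) -/
theorem isABCTriple_breed {a b c : ℕ} (h : IsABCTriple a b c) :
    IsABCTriple (c ^ 5 - b ^ 5) (b ^ 5) (c ^ 5) := by
  obtain ⟨ha, hb, habc, hcop⟩ := h
  have hbc : b < c := by omega
  have hpow : b ^ 5 < c ^ 5 := Nat.pow_lt_pow_left hbc (by norm_num)
  have hcb : Nat.Coprime c b := by
    rw [← habc]; exact Nat.coprime_add_self_left.mpr hcop
  refine ⟨Nat.sub_pos_of_lt hpow, pow_pos hb 5, Nat.sub_add_cancel hpow.le, ?_⟩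
  exact (Nat.coprime_sub_self_left hpow.le).mpr (Nat.Coprime.pow 5 5 hcb)

/-- A product over a union of finsets of positive naturals is at most the product of the products. -/
theorem prod_union_le {s t : Finset ℕ} (h : ∀ p ∈ s ∩ t, 0 < p) :
    (∏ p ∈ s ∪ t, p) ≤ (∏ p ∈ s, p) * ∏ p ∈ t, p := by
  rw [← Finset.prod_union_inter]
  exact Nat.le_mul_of_pos_right _ (Finset.prod_pos h)

/-- **Breeding, radical**: `rad((c⁵−b⁵)·b⁵·c⁵) ≤ rad(abc) · Φ₅(c,b) ≤ rad(abc) · 5c⁴`. -/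
theorem rad_breed_le {a b c : ℕ} (h : IsABCTriple a b c) :
    rad (c ^ 5 - b ^ 5) (b ^ 5) (c ^ 5) ≤ rad a b c * (5 * c ^ 4) := by
  obtain ⟨ha, hb, habc, hcop⟩ := h
  have hc : 0 < c := by omega
  have hbc : b ≤ c := by omega
  have hΦ : 0 < Phi b c := Phi_pos hc
  have hx : c ^ 5 - b ^ 5 = a * Phi b c := pow_five_sub_eq habc
  rw [rad_def, rad_def, hx, Nat.radical_eq_prod_primeFactors, Nat.radical_eq_prod_primeFactors]
  have ha0 : a ≠ 0 := ha.ne'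
  have hb0 : b ≠ 0 := hb.ne'
  have hc0 : c ≠ 0 := hc.ne'
  have hΦ0 : Phi b c ≠ 0 := hΦ.ne'
  have hkey : (a * Phi b c * b ^ 5 * c ^ 5).primeFactors =
      (a * b * c).primeFactors ∪ (Phi b c).primeFactors := by
    rw [Nat.primeFactors_mul (by positivity) (by positivity),
      Nat.primeFactors_mul (by positivity) (by positivity),
      Nat.primeFactors_mul ha0 hΦ0, Nat.primeFactors_pow _ (by norm_num),
      Nat.primeFactors_pow _ (by norm_num),
      Nat.primeFactors_mul (by positivity) hc0, Nat.primeFactors_mul ha0 hb0]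
    ext p
    simp only [Finset.mem_union]
    tauto
  rw [hkey]
  calc (∏ p ∈ (a * b * c).primeFactors ∪ (Phi b c).primeFactors, p)
      ≤ (∏ p ∈ (a * b * c).primeFactors, p) * ∏ p ∈ (Phi b c).primeFactors, p :=
        prod_union_le (fun p hp => (Nat.prime_of_mem_primeFactors (Finset.mem_inter.mp hp).1).pos)
    _ ≤ (∏ p ∈ (a * b * c).primeFactors, p) * (5 * c ^ 4) := by
        apply Nat.mul_le_mul_left
        calc (∏ p ∈ (Phi b c).primeFactors, p) = UniqueFactorizationMonoid.radical (Phi b c) :=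
              (Nat.radical_eq_prod_primeFactors).symm
          _ ≤ Phi b c := Nat.radical_le_self_iff.mpr hΦ0
          _ ≤ 5 * c ^ 4 := Phi_le hbc

/-- **Breeding, depth**: every prime of `bc` is 5-deep in the bred triple. -/
theorem card_le_depth5_breed {a b c : ℕ} (h : IsABCTriple a b c) :
    b.primeFactors.card + c.primeFactors.card ≤ depth5 (c ^ 5 - b ^ 5) (b ^ 5) (c ^ 5) := by
  obtain ⟨ha, hb, habc, hcop⟩ := h
  have hc : 0 < c := by omega
  have hx : c ^ 5 - b ^ 5 = a * Phi b c := pow_five_sub_eq habc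
  have hΦ0 : Phi b c ≠ 0 := (Phi_pos hc).ne'
  have ha0 : a ≠ 0 := ha.ne'
  have hb0 : b ≠ 0 := hb.ne'
  have hc0 : c ≠ 0 := hc.ne'
  have hx0 : c ^ 5 - b ^ 5 ≠ 0 := by rw [hx]; positivity
  have hcb : Nat.Coprime c b := by
    rw [← habc]; exact Nat.coprime_add_self_left.mpr hcop
  set P : ℕ := (c ^ 5 - b ^ 5) * b ^ 5 * c ^ 5 with hP
  have hP0 : P ≠ 0 := by positivity
  have hfac : P.factorization =
      (c ^ 5 - b ^ 5).factorization + 5 • b.factorization + 5 • c.factorization := by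
    rw [hP, Nat.factorization_mul (by positivity) (by positivity),
      Nat.factorization_mul hx0 (by positivity), Nat.factorization_pow, Nat.factorization_pow]
  unfold depth5
  rw [← Finset.card_union_of_disjoint (Nat.Coprime.disjoint_primeFactors hcb.symm)]
  apply Finset.card_le_card
  intro p hp
  rw [Finset.mem_filter]
  have hp' : p.Prime ∧ (p ∣ b ∨ p ∣ c) := by
    rcases Finset.mem_union.mp hp with h | h
    · exact ⟨Nat.prime_of_mem_primeFactors h, Or.inl (Nat.dvd_of_mem_primeFactors h)⟩
    · exact ⟨Nat.prime_of_mem_primeFactors h, Or.inr (Nat.dvd_of_mem_primeFactors h)⟩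
  obtain ⟨hpp, hdvd⟩ := hp'
  constructor
  · rw [Nat.mem_primeFactors]
    refine ⟨hpp, ?_, hP0⟩
    rcases hdvd with h | h
    · exact Dvd.dvd.mul_right (Dvd.dvd.mul_left (dvd_pow h (by norm_num)) _) _
    · exact Dvd.dvd.mul_left (dvd_pow h (by norm_num)) _
  · show 5 ≤ P.factorization p
    rw [hfac]
    simp only [Finsupp.add_apply, Finsupp.smul_apply, smul_eq_mul]
    rcases hdvd with h | h
    · have : 1 ≤ b.factorization p := hpp.factorization_pos_of_dvd hb0 h
      omega
    · have : 1 ≤ c.factorization p := hpp.factorization_pos_of_dvd hc0 h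
      omega

/-- `ω(abc) ≤ ω(a) + ω(b) + ω(c)`. -/
theorem omega_le {a b c : ℕ} (ha : a ≠ 0) (hb : b ≠ 0) (hc : c ≠ 0) :
    omega a b c ≤ a.primeFactors.card + b.primeFactors.card + c.primeFactors.card := by
  unfold omega
  rw [Nat.primeFactors_mul (by positivity) hc, Nat.primeFactors_mul ha hb]
  exact (Finset.card_union_le _ _).trans (Nat.add_le_add_right (Finset.card_union_le _ _) _)

theorem rad_swap (a b c : ℕ) : rad b a c = rad a b c := by
  rw [rad_def, rad_def, mul_comm b a]

theorem isABCTriple_swap {a b c : ℕ} (h : IsABCTriple a b c) : IsABCTriple b a c := by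
  obtain ⟨ha, hb, habc, hcop⟩ := h
  exact ⟨hb, ha, by omega, hcop.symm⟩

/-! ## The real-exponent bookkeeping of one breeding step -/

/-- From `c⁵ < C·(R·5c⁴)^{1+η}` with `0 < 1 − 4η` deduce
`c < (C·5^{1+η})^{1/(1−4η)} · R^{(1+η)/(1−4η)}`. -/
theorem breed_exponent {C R c η : ℝ} (hC : 0 < C) (hR : 1 ≤ R) (hc : 1 ≤ c) (hη : 0 < η)
    (hη4 : 4 * η < 1)
    (h : c ^ (5 : ℕ) < C * (R * (5 * c ^ (4 : ℕ))) ^ (1 + η)) :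
    c < (C * 5 ^ (1 + η)) ^ (1 / (1 - 4 * η)) * R ^ ((1 + η) * (1 / (1 - 4 * η))) := by
  have hc0 : 0 < c := by linarith
  have hR0 : 0 < R := by linarith
  have h1η : 0 ≤ 1 + η := by linarith
  have ht : 0 < 1 - 4 * η := by linarith
  have ht' : 0 < 1 / (1 - 4 * η) := by positivity
  -- expand the right-hand side of `h`
  have hexp : (R * (5 * c ^ (4 : ℕ))) ^ (1 + η) = R ^ (1 + η) * 5 ^ (1 + η) * c ^ (4 * (1 + η)) := by
    rw [Real.mul_rpow hR0.le (by positivity), Real.mul_rpow (by norm_num) (by positivity)]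
    rw [show (c ^ (4 : ℕ) : ℝ) = c ^ (4 : ℝ) by norm_cast, ← Real.rpow_mul hc0.le]
    ring
  rw [hexp] at h
  -- divide by c^{4(1+η)}
  have hc5 : c ^ (5 : ℕ) = c ^ (5 : ℝ) := by norm_cast
  rw [hc5] at h
  have hcpow : 0 < c ^ (4 * (1 + η)) := Real.rpow_pos_of_pos hc0 _
  have h2 : c ^ (5 : ℝ) / c ^ (4 * (1 + η)) < C * 5 ^ (1 + η) * R ^ (1 + η) := by
    rw [div_lt_iff₀ hcpow]
    calc c ^ (5 : ℝ) < C * (R ^ (1 + η) * 5 ^ (1 + η) * c ^ (4 * (1 + η))) := h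
      _ = C * 5 ^ (1 + η) * R ^ (1 + η) * c ^ (4 * (1 + η)) := by ring
  rw [← Real.rpow_sub hc0] at h2
  have hsub : (5 : ℝ) - 4 * (1 + η) = 1 - 4 * η := by ring
  rw [hsub] at h2
  -- raise to the power 1/(1-4η)
  have hlhs : 0 ≤ c ^ (1 - 4 * η) := (Real.rpow_pos_of_pos hc0 _).le
  have h3 := Real.rpow_lt_rpow hlhs h2 ht'
  rw [← Real.rpow_mul hc0.le, show (1 - 4 * η) * (1 / (1 - 4 * η)) = 1 by field_simp,
    Real.rpow_one] at h3
  calc c < (C * 5 ^ (1 + η) * R ^ (1 + η)) ^ (1 / (1 - 4 * η)) := h3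
    _ = (C * 5 ^ (1 + η)) ^ (1 / (1 - 4 * η)) * R ^ ((1 + η) * (1 / (1 - 4 * η))) := by
        rw [Real.mul_rpow (by positivity) (by positivity), Real.rpow_mul hR0.le]

/-! ## The collapse -/

/-- **First lemma of the card (PROVED).** The deep tail implies the many-primes tail:
`DeepRegimeABC → ManyPrimesABC`, with `W(ε) = 2·K(η)`, `η = ε/(5+4ε)`. -/
theorem manyPrimes_of_deepRegime (h : DeepRegimeABC) : ManyPrimesABC := by
  intro ε hε
  set η : ℝ := ε / (5 + 4 * ε) with hηdef
  have h54 : (0 : ℝ) < 5 + 4 * ε := by linarith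
  have hη : 0 < η := by positivity
  have hη4 : 4 * η < 1 := by
    rw [hηdef, ← lt_div_iff₀' (by norm_num : (0:ℝ) < 4), div_lt_div_iff₀ h54 (by norm_num)]
    linarith
  have ht : 0 < 1 - 4 * η := by linarith
  have hexp1 : (1 + η) * (1 / (1 - 4 * η)) = 1 + ε := by
    rw [hηdef]
    field_simp
    ring
  obtain ⟨K, C, hC, hK⟩ := h η hη
  set C' : ℝ := (C * 5 ^ (1 + η)) ^ (1 / (1 - 4 * η)) with hC'def
  have hC' : 0 < C' := Real.rpow_pos_of_pos (by positivity) _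
  -- core step: breed on the pair (b, c)
  have core : ∀ a b c : ℕ, IsABCTriple a b c → K ≤ b.primeFactors.card + c.primeFactors.card →
      (c : ℝ) < C' * ((rad a b c : ℕ) : ℝ) ^ (1 + ε) := by
    intro a b c habc hKbc
    have habc' := isABCTriple_breed habc
    have hdeep : K ≤ depth5 (c ^ 5 - b ^ 5) (b ^ 5) (c ^ 5) :=
      hKbc.trans (card_le_depth5_breed habc)
    have hlt := hK _ _ _ habc' hdeep
    obtain ⟨ha, hb, hsum, hcop⟩ := habc
    have hc1 : (1 : ℝ) ≤ c := by exact_mod_cast (show 1 ≤ c by omega)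
    have hrad_pos : 0 < rad a b c := by
      rw [rad_def]
      exact Nat.pos_of_ne_zero UniqueFactorizationMonoid.radical_ne_zero
    have hR1 : (1 : ℝ) ≤ (rad a b c : ℕ) := by exact_mod_cast hrad_pos
    have hradle : ((rad (c ^ 5 - b ^ 5) (b ^ 5) (c ^ 5) : ℕ) : ℝ) ≤
        (rad a b c : ℕ) * (5 * (c : ℝ) ^ (4 : ℕ)) := by
      exact_mod_cast rad_breed_le ⟨ha, hb, hsum, hcop⟩
    have h1η : 0 ≤ 1 + η := by linarith
    have hstep : ((c : ℝ)) ^ (5 : ℕ) < C * (((rad a b c : ℕ) : ℝ) * (5 * (c : ℝ) ^ (4 : ℕ))) ^ (1 + η) := by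
      have hcast : ((c ^ 5 : ℕ) : ℝ) = (c : ℝ) ^ (5 : ℕ) := by push_cast; ring
      rw [← hcast]
      refine hlt.trans_le ?_
      apply mul_le_mul_of_nonneg_left _ hC.le
      exact Real.rpow_le_rpow (Nat.cast_nonneg _) hradle h1η
    have := breed_exponent hC hR1 hc1 hη hη4 hstep
    rwa [hexp1] at this
  refine ⟨2 * K, C', hC', fun a b c habc hW => ?_⟩
  obtain ⟨ha, hb, hsum, hcop⟩ := habc
  have hω := omega_le ha.ne' hb.ne' (show c ≠ 0 by omega)
  by_cases hcase : a.primeFactors.card ≤ b.primeFactors.card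
  · exact core a b c ⟨ha, hb, hsum, hcop⟩ (by omega)
  · have := core b a c (isABCTriple_swap ⟨ha, hb, hsum, hcop⟩) (by omega)
    rwa [rad_swap] at this

/-- **The collapse (PROVED).** As bare statements, abc on the ε-dependent deep tail and abc on the
ε-dependent many-primes tail are the same: the `5` in the crux is decorative. -/
theorem deepRegime_iff_manyPrimes : DeepRegimeABC ↔ ManyPrimesABC :=
  ⟨manyPrimes_of_deepRegime, deepRegime_of_manyPrimes⟩

/-- Sandwich (PROVED): the transfer target is implied by the summit (`W = 0`). -/
theorem manyPrimes_of_abc (h : _root_.ABC) : ManyPrimesABC := by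
  intro ε hε
  obtain ⟨C, hC, hC'⟩ := (ABC_iff.mp h) ε hε
  exact ⟨0, C, hC, fun a b c habc _ => hC' a b c habc⟩


/-! ## Padding: the UNSATURATED many-primes statement is already ABC

The crux quantifies over triples that USE at least `W` primes (`ω(abc) ≥ W`).  If instead one asks
abc for triples whose support is merely CONTAINED in a set `S` of `≥ W` primes, with the radical
replaced by `∏_{p∈S} p` (the natural "S-unit equation with |S| large" phrasing), the statement is
equivalent to ABC outright: pad the support of an arbitrary triple with the first `W` primes, at the
cost of the constant `(p_W#)^{1+ε}`.  So the entire content of the crux is SATURATION. -/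

/-- abc for S-unit triples with `|S|` large, support only required to lie INSIDE `S`. -/
def ManyPrimesSubsetABC : Prop :=
  ∀ ε : ℝ, 0 < ε → ∃ W : ℕ, ∃ C : ℝ, 0 < C ∧ ∀ S : Finset ℕ, W ≤ S.card → (∀ p ∈ S, p.Prime) →
    ∀ a b c : ℕ, IsABCTriple a b c → (a * b * c).primeFactors ⊆ S →
      (c : ℝ) < C * ((∏ p ∈ S, p : ℕ) : ℝ) ^ (1 + ε)

/-- (PROVED) ABC ⟹ the unsaturated statement (`rad(abc) ≤ ∏_{p ∈ S} p` when `supp(abc) ⊆ S`). -/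
theorem manyPrimesSubset_of_abc (h : _root_.ABC) : ManyPrimesSubsetABC := by
  intro ε hε
  obtain ⟨C, hC, hC'⟩ := (ABC_iff.mp h) ε hε
  refine ⟨0, C, hC, fun S _ hSp a b c habc hsub => (hC' a b c habc).trans_le ?_⟩
  apply mul_le_mul_of_nonneg_left _ hC.le
  apply Real.rpow_le_rpow (Nat.cast_nonneg _) _ (by linarith)
  have hle : rad a b c ≤ ∏ p ∈ S, p := by
    rw [rad_def, Nat.radical_eq_prod_primeFactors]
    exact Finset.prod_le_prod_of_subset_of_one_le' hsub (fun p hp _ => (hSp p hp).one_lt.le)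
  exact_mod_cast hle

/-- **Padding lemma (PROVED).** The unsaturated statement implies ABC: the crux's difficulty is
exactly that a violating triple must USE all of its many primes. -/
theorem abc_of_manyPrimesSubset (h : ManyPrimesSubsetABC) : _root_.ABC := by
  rw [ABC_iff]
  intro ε hε
  obtain ⟨W, C, hC, hW⟩ := h ε hε
  -- padding set: the first `W` primes
  set T : Finset ℕ := (Finset.range W).image (Nat.nth Nat.Prime) with hTdef
  have hTprime : ∀ p ∈ T, p.Prime := by
    intro p hp
    obtain ⟨i, -, rfl⟩ := Finset.mem_image.mp hp
    exact Nat.prime_nth_prime i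
  have hTcard : T.card = W := by
    rw [hTdef, Finset.card_image_of_injective _ (Nat.nth_injective Nat.infinite_setOf_prime),
      Finset.card_range]
  set P : ℕ := ∏ p ∈ T, p with hPdef
  have hP : 0 < P := Finset.prod_pos (fun p hp => (hTprime p hp).pos)
  have h1ε : (0 : ℝ) ≤ 1 + ε := by linarith
  refine ⟨C * (P : ℝ) ^ (1 + ε), by positivity, fun a b c habc => ?_⟩
  obtain ⟨ha, hb, hsum, hcop⟩ := habc
  have hc : 0 < c := by omega
  set S : Finset ℕ := (a * b * c).primeFactors ∪ T with hSdef
  have hS : W ≤ S.card := by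
    rw [← hTcard]; exact Finset.card_le_card Finset.subset_union_right
  have hSprime : ∀ p ∈ S, p.Prime := by
    intro p hp
    rcases Finset.mem_union.mp hp with h | h
    · exact Nat.prime_of_mem_primeFactors h
    · exact hTprime p h
  have hlt := hW S hS hSprime a b c ⟨ha, hb, hsum, hcop⟩ Finset.subset_union_left
  have hprod : (∏ p ∈ S, p) ≤ rad a b c * P := by
    rw [rad_def, Nat.radical_eq_prod_primeFactors, hSdef, hPdef]
    exact prod_union_le (fun p hp => (hTprime p (Finset.mem_inter.mp hp).2).pos)
  have hprodR : ((∏ p ∈ S, p : ℕ) : ℝ) ≤ (rad a b c : ℕ) * (P : ℝ) := by exact_mod_cast hprod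
  calc (c : ℝ) < C * ((∏ p ∈ S, p : ℕ) : ℝ) ^ (1 + ε) := hlt
    _ ≤ C * (((rad a b c : ℕ) : ℝ) * (P : ℝ)) ^ (1 + ε) := by
        apply mul_le_mul_of_nonneg_left _ hC.le
        exact Real.rpow_le_rpow (Nat.cast_nonneg _) hprodR h1ε
    _ = C * (P : ℝ) ^ (1 + ε) * ((rad a b c : ℕ) : ℝ) ^ (1 + ε) := by
        rw [Real.mul_rpow (Nat.cast_nonneg _) (Nat.cast_nonneg _)]; ring

/-- (PROVED) Hence the unsaturated statement is just ABC, while the saturated one is the crux. -/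
theorem manyPrimesSubset_iff_abc : ManyPrimesSubsetABC ↔ _root_.ABC :=
  ⟨abc_of_manyPrimesSubset, manyPrimesSubset_of_abc⟩


/-! ## The complement theorem, now sorry-free

Round 1 (`Cruxes/DepthUniformity/SketchIdeator1.lean`) typed `abc_of_deepRegime_of_boundedOmega` with a sorry.
With the collapse it is a two-line case split. -/

/-- **BoundedOmegaABC**: abc on each cell `ω(abc) ≤ W`, constant depending on `W` — the S-unit / Pillai
corner with moving primes (same statement as round 1's). -/
def BoundedOmegaABC : Prop :=
  ∀ W : ℕ, ∀ ε : ℝ, 0 < ε → ∃ C : ℝ, 0 < C ∧ ∀ a b c : ℕ, IsABCTriple a b c → omega a b c ≤ W →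
    (c : ℝ) < C * ((rad a b c : ℕ) : ℝ) ^ (1 + ε)

/-- (PROVED) structured corner ∧ generic tail ⟹ ABC: case split at the single cell `W(ε)`. -/
theorem abc_of_boundedOmega_of_manyPrimes (h₁ : BoundedOmegaABC) (h₂ : ManyPrimesABC) : _root_.ABC := by
  rw [ABC_iff]
  intro ε hε
  obtain ⟨W, C₁, hC₁, hW⟩ := h₂ ε hε
  obtain ⟨C₂, _hC₂, hW'⟩ := h₁ W ε hε
  refine ⟨max C₁ C₂, lt_max_of_lt_left hC₁, fun a b c habc => ?_⟩
  have hr : (0 : ℝ) ≤ ((rad a b c : ℕ) : ℝ) ^ (1 + ε) := Real.rpow_nonneg (Nat.cast_nonneg _) _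
  by_cases hK : W ≤ omega a b c
  · exact (hW a b c habc hK).trans_le (mul_le_mul_of_nonneg_right (le_max_left _ _) hr)
  · exact (hW' a b c habc (not_le.mp hK).le).trans_le (mul_le_mul_of_nonneg_right (le_max_right _ _) hr)

/-- (PROVED) round 1's complement theorem, sorry-free: `DeepRegimeABC ∧ BoundedOmegaABC → ABC`. -/
theorem abc_of_deepRegime_of_boundedOmega (h₁ : DeepRegimeABC) (h₂ : BoundedOmegaABC) : _root_.ABC :=
  abc_of_boundedOmega_of_manyPrimes h₂ (manyPrimes_of_deepRegime h₁)

theorem boundedOmega_of_abc (h : _root_.ABC) : BoundedOmegaABC := by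
  intro W ε hε
  obtain ⟨C, hC, hC'⟩ := (ABC_iff.mp h) ε hε
  exact ⟨C, hC, fun a b c habc _ => hC' a b c habc⟩

/-- (PROVED) **ABC ⟺ structured corner ∧ generic tail.** -/
theorem abc_iff_boundedOmega_and_manyPrimes : _root_.ABC ↔ BoundedOmegaABC ∧ ManyPrimesABC :=
  ⟨fun h => ⟨boundedOmega_of_abc h, manyPrimes_of_abc h⟩,
   fun h => abc_of_boundedOmega_of_manyPrimes h.1 h.2⟩

/-- (PROVED) **Level-one re-base of the route's deciding theorem**: the route's mechanism crux
`UniformSadicTowerFour` already contains the structured corner (take `S := primeFactors(abc)`, any lift with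
`∏ xᵢ^(i+1) = a`: the S-free part of `∏ xᵢyᵢzᵢ` is `1`), so `closes` needs the residue only in its level-free
form `ManyPrimesABC`.  Here we record the logical shape with the corner as an explicit hypothesis; the
dictionary `UniformSadicTowerFour → BoundedOmegaABC` is the `S ⊇ supp` instance of the route's proved support
`TowerFourGivesDepthCounted` and is left to the route (not load-bearing for this card). -/
theorem closes_rebased (hcorner : BoundedOmegaABC) (htail : ManyPrimesABC) : _root_.ABC :=
  abc_of_boundedOmega_of_manyPrimes hcorner htail

end Summit.ABC.ABC.Cruxes.DeepRegimeABC.OmegaCollapse
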